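import Literature.NumberTheory.Automorphic.ArchWhittakerGL2Letters
import Literature.NumberTheory.Automorphic.ArchGardingDensityRiesz
import Literature.Algebra.Lie.WhittakerFunctionalDescent
import HarnessLib

/-!
# Whittaker functionals of `GL₂(K_∞)` are continuous for the `P`-Sobolev seminorms (JS I, Prop. (3.8), `r = 2`)

Topic `NumberTheory/Automorphic`; namespace `Literature.NumberTheory.Automorphic`. Definitions with
bodies and theorems (no named fact). For an irreducible unitary strongly continuous representation `τ`
of `GL₂(K_∞)` on a Hilbert space `E` with Gårding space `𝒢`, and a continuous `ψ_∞`-Whittaker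
functional `ℓ` on `𝒢` (`IsArchContWhittakerFunctional`: `N_∞`-covariant and bounded by finitely many
`U(𝔤)`-seminorms `‖τ(w) v‖`):

* `IsArchContWhittakerFunctional.norm_le_sum_pWords` — **`ℓ` is bounded by finitely many
  `U(𝔭)`-seminorms**: `‖ℓ v‖ ≤ C Σ_{w ∈ 𝒮'} ‖τ(w) v‖` with every word `w ∈ 𝒮'` made of letters
  `X ∈ 𝔭 = Lie(P₂)` (`X₁₀ = X₁₁ = 0`). This is Jacquet–Shalika (1981), Prop. (3.8) ("`λ` extends
  continuously to `ℋ_P^∞`") for `r = 2`, by their argument: write `ℓ = Σ_w ⟪y_w, τ(w) ·⟫` (Riesz,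
  `ArchGardingDensityRiesz`), order each word as (element of `B = ℂ⟨τ(𝔭), centre⟩) × (monomial in the
  lowering letters `e⁻_a = τ(E₁₀ ⊗ ·)`) (`WhittakerFunctionalFiltration`), and remove the lowering
  letters one at a time using `ℓ ∘ e⁺_a = θ_a ℓ`, `θ_a ≠ 0`, `[e⁻_a, e⁺_{a'}] = 0` (`a ≠ a'`) and
  `e⁻_a e⁺_a ∈ B` (Casimir) (`WhittakerFunctionalDescent.mem_zero_of_mem_of_covariant`, with the
  letter relations of `ArchWhittakerGL2Letters`). What is left is a finite sum `Σ ⟪y, b ·⟫`, `b ∈ B`,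
  bounded by `U(𝔭)`-seminorms.

This is brick (B4) of the closability route to
`Literature.NumberTheory.Automorphic.JacquetShalika1981_archKirillovNorm_le 1 K`.

## References

* H. Jacquet, J. A. Shalika, *On Euler products and the classification of automorphic
  representations I*, Amer. J. Math. 103 (1981), §3, Prop. (3.8), pp. 522–523 [JacquetShalikaAJM1981].
-/

noncomputable section

open MeasureTheory Measure NumberField NumberField.mixedEmbedding NumberField.InfinitePlace IsDedekindDomain Set Filter
  Complex
open scoped MatrixGroups ENNReal NNReal Classical Topology InnerProductSpace ComplexConjugate Real

namespace Literature.NumberTheory.Automorphic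

variable {K : Type} [Field K] [NumberField K]

attribute [local instance] glInfBorel borelSpace_glInf locallyCompactSpace_glInf secondCountableTopology_glInf

-- as in `ArchGardingWhittaker`
set_option backward.isDefEq.respectTransparency false

open Literature.Algebra.Lie.WhittakerDescent

variable {hcpt : isCompact_glFiniteIntegralLevel 2 K}
  {E : Type*} [NormedAddCommGroup E] [InnerProductSpace ℂ E] [CompleteSpace E]
  {τ : ContRepresentation ℂ (AutomorphyDatum.gl 2 K hcpt).arch.carrier E}

/-! ### 1. The filtration of functionals -/

variable (hcpt τ) in
/-- The functional `v ↦ ⟪y, v⟫` on the Gårding space. [folklore] -/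
def innerFunctional (y : E) : archGardingSpace hcpt τ →ₗ[ℂ] ℂ :=
  (innerₛₗ ℂ y).comp (archGardingSpace hcpt τ).subtype

omit [CompleteSpace E] in
/-- Unfolding of `innerFunctional`. [folklore] -/
@[simp] theorem innerFunctional_apply (y : E) (v : archGardingSpace hcpt τ) :
    innerFunctional hcpt τ y v = ⟪y, (v : E)⟫_ℂ := rfl

variable (hcpt τ) in
/-- **`W₀`**: the span of the functionals `v ↦ ⟪y, b v⟫`, `y ∈ E`, `b ∈ B` (the "`P`-continuous"
functionals of degree `0`; Jacquet–Shalika's `ℋ^{0}`-dual). [cite: JacquetShalikaAJM1981, §3, proof of Prop. (3.8)] -/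
def borelFunctionals (hτ : τ.IsStronglyContinuous) : Submodule ℂ (archGardingSpace hcpt τ →ₗ[ℂ] ℂ) :=
  Submodule.span ℂ {μ | ∃ (y : E) (b : Module.End ℂ (archGardingSpace hcpt τ)), b ∈ borelAlg hcpt τ hτ ∧
    μ = (innerFunctional hcpt τ y).comp b}

/-- `W₀` is stable under right composition with `B`. [folklore] -/
theorem comp_mem_borelFunctionals (hτ : τ.IsStronglyContinuous) {b : Module.End ℂ (archGardingSpace hcpt τ)}
    (hb : b ∈ borelAlg hcpt τ hτ) {μ : archGardingSpace hcpt τ →ₗ[ℂ] ℂ} (hμ : μ ∈ borelFunctionals hcpt τ hτ) :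
    μ.comp b ∈ borelFunctionals hcpt τ hτ := by
  induction hμ using Submodule.span_induction with
  | mem x hx =>
    obtain ⟨y, b', hb', rfl⟩ := hx
    refine Submodule.subset_span ⟨y, b' * b, Subalgebra.mul_mem _ hb' hb, ?_⟩
    rw [Module.End.mul_eq_comp, LinearMap.comp_assoc]
  | zero => rw [LinearMap.zero_comp]; exact Submodule.zero_mem _
  | add x y _ _ hx hy => rw [LinearMap.add_comp]; exact Submodule.add_mem _ hx hy
  | smul c x _ hx => rw [LinearMap.smul_comp]; exact Submodule.smul_mem _ c hx

/-- `v ↦ ⟪y, v⟫` lies in `W₀`. [folklore] -/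
theorem innerFunctional_mem_borelFunctionals (hτ : τ.IsStronglyContinuous) (y : E) :
    innerFunctional hcpt τ y ∈ borelFunctionals hcpt τ hτ :=
  Submodule.subset_span ⟨y, 1, Subalgebra.one_mem _, by rw [Module.End.one_eq_id, LinearMap.comp_id]⟩

variable (hcpt τ) in
/-- **`W_J`**: functionals of `e⁻`-degree `≤ J` over `W₀` (`W_{J+1} = W_J + Σ_a W_J ∘ e⁻_a`). [cite: JacquetShalikaAJM1981, §3, proof of Prop. (3.8)] -/
def whittakerFilt (hτ : τ.IsStronglyContinuous) (J : ℕ) : Submodule ℂ (archGardingSpace hcpt τ →ₗ[ℂ] ℂ) :=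
  Nat.rec (borelFunctionals hcpt τ hτ) (fun _ W => repSubmodule W (placeLetter hτ 1 0)) J

/-- `W_0 = borelFunctionals`. [folklore] -/
theorem whittakerFilt_zero (hτ : τ.IsStronglyContinuous) : whittakerFilt hcpt τ hτ 0 = borelFunctionals hcpt τ hτ := rfl

/-- `W_{J+1} = repSubmodule (W_J) e⁻`. [folklore] -/
theorem whittakerFilt_succ (hτ : τ.IsStronglyContinuous) (J : ℕ) :
    whittakerFilt hcpt τ hτ (J + 1) = repSubmodule (whittakerFilt hcpt τ hτ J) (placeLetter hτ 1 0) := rfl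

/-- The filtration is increasing. [folklore] -/
theorem whittakerFilt_mono (hτ : τ.IsStronglyContinuous) {J J' : ℕ} (h : J ≤ J') :
    whittakerFilt hcpt τ hτ J ≤ whittakerFilt hcpt τ hτ J' := by
  induction h with
  | refl => exact le_rfl
  | step _ ih => exact ih.trans (le_repSubmodule _ _)

/-! ### 2. `ℓ` has finite degree, hence degree `0` -/

/-- **A continuous Whittaker functional has finite `e⁻`-degree**: `ℓ ∈ W_J` for some `J` (Riesz form
`ℓ = Σ_w ⟪y_w, τ(w) ·⟫` and the degree of the word operators). [cite: JacquetShalikaAJM1981, §3, proof of Prop. (3.8), p. 523] -/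
theorem IsArchContWhittakerFunctional.exists_mem_whittakerFilt {hτ : τ.IsStronglyContinuous}
    {ℓ : archGardingSpace hcpt τ →ₗ[ℂ] ℂ} (hℓ : IsArchContWhittakerFunctional hcpt τ hτ ℓ)
    (hτu : τ.IsUnitary) (hτi : τ.IsTopIrreducible) : ∃ J, ℓ ∈ whittakerFilt hcpt τ hτ J := by
  obtain ⟨𝒮, y, hy⟩ := hℓ.exists_eq_sum_inner
  have hJ : ∀ w : List (Matrix (Fin 2) (Fin 2) (mixedSpace K)), ∃ J,
      (w.map (gardingEnd (hcpt := hcpt) (τ := τ) hτ)).prod ∈ degFilt (borelAlg hcpt τ hτ) (placeLetter hτ 1 0) J :=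
    fun w => exists_mem_degFilt_prod_map_gardingEnd hτ hτu hτi w
  choose J hJ using hJ
  refine ⟨𝒮.sup J, ?_⟩
  have hℓeq : ℓ = ∑ w ∈ 𝒮, (innerFunctional hcpt τ (y w)).comp ((w.map (gardingEnd (hcpt := hcpt) (τ := τ) hτ)).prod) := by
    refine LinearMap.ext fun v => ?_
    rw [hy v, LinearMap.sum_apply]
    refine Finset.sum_congr rfl fun w _ => ?_
    rw [LinearMap.comp_apply, innerFunctional_apply, coe_prod_map_gardingEnd_apply]
  rw [hℓeq]
  refine Submodule.sum_mem _ fun w hw => whittakerFilt_mono hτ (Finset.le_sup hw) ?_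
  exact comp_mem_of_mem_degFilt (borelAlg hcpt τ hτ) (placeLetter hτ 1 0) (whittakerFilt hcpt τ hτ)
    (fun b hb μ hμ => comp_mem_borelFunctionals hτ hb hμ) (fun J => rfl)
    (innerFunctional_mem_borelFunctionals hτ (y w)) (J w) (hJ w)

/-- **A continuous Whittaker functional has degree `0`**: `ℓ ∈ W₀ = span{⟪y, b ·⟫ : b ∈ B}` — the
descent `W_J → W_{J-1} → ⋯ → W₀` of Jacquet–Shalika. [cite: JacquetShalikaAJM1981, §3, proof of Prop. (3.8), p. 523] -/
theorem IsArchContWhittakerFunctional.mem_borelFunctionals {hτ : τ.IsStronglyContinuous}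
    {ℓ : archGardingSpace hcpt τ →ₗ[ℂ] ℂ} (hℓ : IsArchContWhittakerFunctional hcpt τ hτ ℓ)
    (hτu : τ.IsUnitary) (hτi : τ.IsTopIrreducible) : ℓ ∈ borelFunctionals hcpt τ hτ := by
  obtain ⟨J, hJ⟩ := hℓ.exists_mem_whittakerFilt hτu hτi
  exact mem_zero_of_mem_of_covariant (placeLetter hτ 1 0) (placeLetter hτ 0 1) letterChar (borelAlg hcpt τ hτ)
    (whittakerFilt hcpt τ hτ) (fun b hb μ hμ => comp_mem_borelFunctionals hτ hb hμ)
    (mem_succ_iff_of_eq_repSubmodule _ _ fun J => rfl)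
    (fun a b hb => placeLetter10_mul_mem hτ hτu hτi a hb)
    (fun a => placeLetter_mem_of_ne hτ hτu hτi (by simp) a)
    (fun a => placeLetter10_mul_placeLetter01_mem hτ hτu hτi a)
    (fun a a' h => placeLetter10_mul_placeLetter01_of_ne hτ h)
    letterChar_ne_zero (comp_placeLetter01 hℓ) hJ

/-! ### 3. `U(𝔭)`-seminorm bounds -/

/-- Words in `𝔭 = Lie(P₂)`: every letter has vanishing second row. [folklore] -/
def IsPWord (w : List (Matrix (Fin 2) (Fin 2) (mixedSpace K))) : Prop := ∀ X ∈ w, X 1 0 = 0 ∧ X 1 1 = 0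

omit [NumberField K] in
/-- The empty word is a `𝔭`-word. [folklore] -/
theorem isPWord_nil : IsPWord (K := K) [] := fun _ hX => absurd hX List.not_mem_nil

omit [NumberField K] in
/-- Appending a letter `E_{0j} ⊗ x` keeps a `𝔭`-word. [folklore] -/
theorem IsPWord.append_single {w : List (Matrix (Fin 2) (Fin 2) (mixedSpace K))} (hw : IsPWord w) (j : Fin 2) (x : mixedSpace K) :
    IsPWord (w ++ [Matrix.single 0 j x]) := by
  intro X hX
  rw [List.mem_append, List.mem_singleton] at hX
  rcases hX with hX | rfl
  · exact hw X hX
  · constructor <;> simp [Matrix.single]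

omit [CompleteSpace E] in
/-- Monotonicity of the seminorm sums in the index set. [folklore] -/
theorem sum_norm_archWordDerivE_mono {𝒮 𝒮' : Finset (List (Matrix (Fin 2) (Fin 2) (mixedSpace K)))} (h : 𝒮 ⊆ 𝒮') (v : E) :
    ∑ w ∈ 𝒮, ‖archWordDerivE hcpt τ w v‖ ≤ ∑ w ∈ 𝒮', ‖archWordDerivE hcpt τ w v‖ :=
  Finset.sum_le_sum_of_subset_of_nonneg h fun _ _ _ => norm_nonneg _

/-- **Elements of `B` are bounded by `U(𝔭)`-seminorms, uniformly after any `𝔭`-word**: for `b ∈ B`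
and a `𝔭`-word `u`, `‖τ(u) (b v)‖ ≤ C Σ_{w ∈ 𝒮'} ‖τ(w) v‖` with `𝔭`-words `w`. [folklore] -/
theorem exists_bound_of_mem_borelAlg (hτ : τ.IsStronglyContinuous) {b : Module.End ℂ (archGardingSpace hcpt τ)}
    (hb : b ∈ borelAlg hcpt τ hτ) :
    ∀ u : List (Matrix (Fin 2) (Fin 2) (mixedSpace K)), IsPWord u →
      ∃ (C : ℝ) (𝒮' : Finset (List (Matrix (Fin 2) (Fin 2) (mixedSpace K)))), 0 ≤ C ∧ (∀ w ∈ 𝒮', IsPWord w) ∧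
        ∀ v : archGardingSpace hcpt τ, ‖archWordDerivE hcpt τ u ((b v : archGardingSpace hcpt τ) : E)‖ ≤
          C * ∑ w ∈ 𝒮', ‖archWordDerivE hcpt τ w (v : E)‖ := by
  induction hb using Algebra.adjoin_induction with
  | mem t ht =>
    intro u hu
    rcases ht with ⟨x, rfl⟩ | ⟨x, rfl⟩
    · refine ⟨1, {u ++ [Matrix.single 0 0 x]}, zero_le_one, fun w hw => ?_, fun v => ?_⟩
      · rw [Finset.mem_singleton] at hw; rw [hw]; exact hu.append_single 0 x
      · rw [Finset.sum_singleton, one_mul, archWordDerivE_append, archWordDerivE_cons, archWordDerivE_nil, coe_gardingEnd_apply]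
    · refine ⟨1, {u ++ [Matrix.single 0 1 x]}, zero_le_one, fun w hw => ?_, fun v => ?_⟩
      · rw [Finset.mem_singleton] at hw; rw [hw]; exact hu.append_single 1 x
      · rw [Finset.sum_singleton, one_mul, archWordDerivE_append, archWordDerivE_cons, archWordDerivE_nil, coe_gardingEnd_apply]
  | algebraMap c =>
    intro u hu
    refine ⟨‖c‖, {u}, norm_nonneg c, fun w hw => ?_, fun v => ?_⟩
    · rw [Finset.mem_singleton] at hw; rw [hw]; exact hu
    · rw [Finset.sum_singleton, Algebra.algebraMap_eq_smul_one, LinearMap.smul_apply, Module.End.one_apply, Submodule.coe_smul,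
        archWordDerivE_smul hτ c v.2 u, _root_.norm_smul]
  | add x x' _ _ ihx ihx' =>
    intro u hu
    obtain ⟨C, 𝒮, hC, h𝒮, h⟩ := ihx u hu
    obtain ⟨C', 𝒮', hC', h𝒮', h'⟩ := ihx' u hu
    refine ⟨C + C', 𝒮 ∪ 𝒮', add_nonneg hC hC', fun w hw => ?_, fun v => ?_⟩
    · rcases Finset.mem_union.1 hw with hw | hw
      · exact h𝒮 w hw
      · exact h𝒮' w hw
    · rw [LinearMap.add_apply, Submodule.coe_add, archWordDerivE_add hτ (x v).2 (x' v).2 u]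
      calc ‖archWordDerivE hcpt τ u ((x v : archGardingSpace hcpt τ) : E) + archWordDerivE hcpt τ u ((x' v : archGardingSpace hcpt τ) : E)‖
          ≤ C * ∑ w ∈ 𝒮, ‖archWordDerivE hcpt τ w (v : E)‖ + C' * ∑ w ∈ 𝒮', ‖archWordDerivE hcpt τ w (v : E)‖ :=
            (norm_add_le _ _).trans (add_le_add (h v) (h' v))
        _ ≤ C * ∑ w ∈ 𝒮 ∪ 𝒮', ‖archWordDerivE hcpt τ w (v : E)‖ + C' * ∑ w ∈ 𝒮 ∪ 𝒮', ‖archWordDerivE hcpt τ w (v : E)‖ :=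
            add_le_add (mul_le_mul_of_nonneg_left (sum_norm_archWordDerivE_mono Finset.subset_union_left _) hC)
              (mul_le_mul_of_nonneg_left (sum_norm_archWordDerivE_mono Finset.subset_union_right _) hC')
        _ = (C + C') * ∑ w ∈ 𝒮 ∪ 𝒮', ‖archWordDerivE hcpt τ w (v : E)‖ := by ring
  | mul x x' _ _ ihx ihx' =>
    intro u hu
    obtain ⟨C, 𝒮, hC, h𝒮, h⟩ := ihx u hu
    choose! Cf 𝒮f hCf h𝒮f hbf using ihx'
    refine ⟨C * ∑ w ∈ 𝒮, Cf w, 𝒮.biUnion 𝒮f, mul_nonneg hC (Finset.sum_nonneg fun w hw => hCf w (h𝒮 w hw)), fun w hw => ?_, fun v => ?_⟩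
    · obtain ⟨w₀, hw₀, hw⟩ := Finset.mem_biUnion.1 hw
      exact h𝒮f w₀ (h𝒮 w₀ hw₀) w hw
    · rw [Module.End.mul_apply]
      calc ‖archWordDerivE hcpt τ u ((x (x' v) : archGardingSpace hcpt τ) : E)‖
          ≤ C * ∑ w ∈ 𝒮, ‖archWordDerivE hcpt τ w ((x' v : archGardingSpace hcpt τ) : E)‖ := h (x' v)
        _ ≤ C * ∑ w ∈ 𝒮, Cf w * ∑ w' ∈ 𝒮.biUnion 𝒮f, ‖archWordDerivE hcpt τ w' (v : E)‖ := by
            refine mul_le_mul_of_nonneg_left (Finset.sum_le_sum fun w hw => ?_) hC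
            exact (hbf w (h𝒮 w hw) v).trans (mul_le_mul_of_nonneg_left
              (sum_norm_archWordDerivE_mono (Finset.subset_biUnion_of_mem 𝒮f hw) _) (hCf w (h𝒮 w hw)))
        _ = (C * ∑ w ∈ 𝒮, Cf w) * ∑ w' ∈ 𝒮.biUnion 𝒮f, ‖archWordDerivE hcpt τ w' (v : E)‖ := by
            rw [mul_assoc, Finset.sum_mul]

/-- **Jacquet–Shalika (1981), Prop. (3.8) for `GL₂(K_∞)`: a continuous Whittaker functional on the
Gårding space of an irreducible unitary representation is continuous for the `U(𝔭)`-seminorms**: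
`‖ℓ v‖ ≤ C Σ_{w ∈ 𝒮'} ‖τ(w) v‖` with all words `w` in letters `X ∈ 𝔭` (`X₁₀ = X₁₁ = 0`), i.e. `ℓ`
extends continuously to the `P₂(K_∞)`-smooth vectors. [cite: JacquetShalikaAJM1981, §3, Prop. (3.8), pp. 522–523] -/
theorem IsArchContWhittakerFunctional.norm_le_sum_pWords {hτ : τ.IsStronglyContinuous}
    {ℓ : archGardingSpace hcpt τ →ₗ[ℂ] ℂ} (hℓ : IsArchContWhittakerFunctional hcpt τ hτ ℓ)
    (hτu : τ.IsUnitary) (hτi : τ.IsTopIrreducible) :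
    ∃ (C : ℝ) (𝒮' : Finset (List (Matrix (Fin 2) (Fin 2) (mixedSpace K)))), 0 ≤ C ∧
      (∀ w ∈ 𝒮', ∀ X ∈ w, X 1 0 = 0 ∧ X 1 1 = 0) ∧
      ∀ v : archGardingSpace hcpt τ, ‖ℓ v‖ ≤ C * ∑ w ∈ 𝒮', ‖archWordDerivE hcpt τ w (v : E)‖ := by
  have hmem := hℓ.mem_borelFunctionals hτu hτi
  unfold borelFunctionals at hmem
  clear hℓ
  induction hmem using Submodule.span_induction with
  | mem μ hμ =>
    obtain ⟨y, b, hb, rfl⟩ := hμ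
    obtain ⟨C, 𝒮', hC, h𝒮', h⟩ := exists_bound_of_mem_borelAlg hτ hb [] isPWord_nil
    refine ⟨‖y‖ * C, 𝒮', mul_nonneg (norm_nonneg y) hC, h𝒮', fun v => ?_⟩
    rw [LinearMap.comp_apply, innerFunctional_apply, mul_assoc]
    refine (norm_inner_le_norm _ _).trans (mul_le_mul_of_nonneg_left ?_ (norm_nonneg y))
    simpa only [archWordDerivE_nil] using h v
  | zero => exact ⟨0, ∅, le_rfl, fun w hw => absurd hw (Finset.notMem_empty w), fun v => by simp⟩
  | add μ μ' _ _ ih ih' =>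
    obtain ⟨C, 𝒮, hC, h𝒮, h⟩ := ih
    obtain ⟨C', 𝒮', hC', h𝒮', h'⟩ := ih'
    refine ⟨C + C', 𝒮 ∪ 𝒮', add_nonneg hC hC', fun w hw => ?_, fun v => ?_⟩
    · rcases Finset.mem_union.1 hw with hw | hw
      · exact h𝒮 w hw
      · exact h𝒮' w hw
    · rw [LinearMap.add_apply]
      calc ‖μ v + μ' v‖ ≤ C * ∑ w ∈ 𝒮, ‖archWordDerivE hcpt τ w (v : E)‖ + C' * ∑ w ∈ 𝒮', ‖archWordDerivE hcpt τ w (v : E)‖ :=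
            (norm_add_le _ _).trans (add_le_add (h v) (h' v))
        _ ≤ C * ∑ w ∈ 𝒮 ∪ 𝒮', ‖archWordDerivE hcpt τ w (v : E)‖ + C' * ∑ w ∈ 𝒮 ∪ 𝒮', ‖archWordDerivE hcpt τ w (v : E)‖ :=
            add_le_add (mul_le_mul_of_nonneg_left (sum_norm_archWordDerivE_mono Finset.subset_union_left _) hC)
              (mul_le_mul_of_nonneg_left (sum_norm_archWordDerivE_mono Finset.subset_union_right _) hC')
        _ = (C + C') * ∑ w ∈ 𝒮 ∪ 𝒮', ‖archWordDerivE hcpt τ w (v : E)‖ := by ring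
  | smul c μ _ ih =>
    obtain ⟨C, 𝒮, hC, h𝒮, h⟩ := ih
    refine ⟨‖c‖ * C, 𝒮, mul_nonneg (norm_nonneg c) hC, h𝒮, fun v => ?_⟩
    rw [LinearMap.smul_apply, _root_.norm_smul, mul_assoc]
    exact mul_le_mul_of_nonneg_left (h v) (norm_nonneg c)

end Literature.NumberTheory.Automorphic
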